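import Literature.Geometry.Riemannian.RiemannianDistance
import Literature.Geometry.Riemannian.CanonicalNeighbourhoods
import Literature.Geometry.Lorentzian.VolumeChartFormula
import Literature.Geometry.Lorentzian.EnergyCurrents
import HarnessLib

/-!
# Charts are locally bi-Lipschitz for the Riemannian distance; comparison of the Riemannian
# measure with the Hausdorff measure of the model space (Federer 1969, §2.10.11)

For a smooth Riemannian metric `g` (a Riemannian `PseudoRiemannianMetric` on `TM`) on a regular
manifold `M` modelled on an ARBITRARY finite-dimensional real normed space `E` (boundaryless
model) — the generality of the facts of `CanonicalNeighbourhoods.lean` — we prove the two basic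
comparison tools between `(M, d_g, Vol_g)` and `(E, ‖·‖, μHE[n])`, `n = dim M`, that underlie every
transfer of Euclidean integral inequalities (Sobolev, Poincaré) to closed manifolds by partitions
of unity:

* `exists_isOpen_biLipschitz_extChartAt` — every `x₀` has an open neighbourhood `U` in the domain
  of `φ = extChartAt I x₀` on which, for one constant `C`, `d_g(q,q') ≤ C ‖φ q - φ q'‖`,
  `‖φ q - φ q'‖ ≤ C d_g(q,q')` and `|D(φ⁻¹)_{φ q} w|_g ≤ C ‖w‖` (from Mathlib's local derivative
  bounds `eventually_norm_mfderivWithin_symm_extChartAt_lt`, `eventually_norm_mfderiv_extChartAt_lt`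
  and the path-length estimates of `VolumeChartFormula.lean`; Burago–Burago–Ivanov 2001, §5.1);
* `vol_le_and_le_of_biLipschitz` — on such a `U`, `Vol_g(s) ≤ Cⁿ μHE[n](φ s)` and
  `μHE[n](φ s) ≤ Cⁿ Vol_g(s)` for all `s ⊆ U` (`Vol_g = g.riemVolume` is the Euclidean-normalised
  Hausdorff measure of `d_g`, and Lipschitz maps expand `μH[n]` by at most `Lipⁿ`,
  Federer 1969, §2.10.11, Mathlib's `LipschitzOnWith.hausdorffMeasure_image_le`);
* `lintegral_le_and_le_of_biLipschitz` — hence, for `U` open and `f ≥ 0` measurable,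
  `∫_U f dVol_g ≤ Cⁿ ∫_{φ U} f ∘ φ⁻¹ dμHE[n]` and `∫_{φ U} f ∘ φ⁻¹ dμHE[n] ≤ Cⁿ ∫_U f dVol_g`
  (the push-forward `(φ⁻¹)_* μHE[n]|_{φ U}` is squeezed between `C^{∓n} Vol_g|_U`).

On `E`, `μHE[n]` is an additive Haar measure (Mathlib's `isAddHaarMeasure_euclideanHausdorffMeasure`),
so Euclidean inequalities stated for Haar measures apply in the chart. No inner product on `E` and
no `√(det g_{ij})` is needed (contrast `VolumeChartFormula.lean`, which gives the sharp chart
formula for Euclidean models). Everything is proved; no definitions, no named facts.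

## References

* H. Federer, *Geometric Measure Theory*, Springer 1969, §2.10.11 (Hausdorff measure under
  Lipschitz maps), §3.2.46. [Federer1969]
* D. Burago, Yu. Burago, S. Ivanov, *A course in metric geometry*, AMS 2001, §5.1 (Riemannian
  length structures; charts are locally bi-Lipschitz).
-/

noncomputable section

open Bundle Set Function Filter Manifold MeasureTheory Metric Module
open scoped Manifold ContDiff Topology ENNReal NNReal

namespace Literature.Geometry.Riemannian

open Lorentzian

section BiLipschitz

variable {E : Type*} [NormedAddCommGroup E] [NormedSpace ℝ E] [FiniteDimensional ℝ E]
  {H : Type*} [TopologicalSpace H] {I : ModelWithCorners ℝ E H} [I.Boundaryless]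
  {M : Type*} [TopologicalSpace M] [ChartedSpace H M] [IsManifold I ∞ M]
  (g : PseudoRiemannianMetric I ∞ E (TangentSpace I : M → Type _))

set_option backward.isDefEq.respectTransparency false in
/-- **Charts are locally bi-Lipschitz for the Riemannian distance, with derivative bounds.**
For a smooth Riemannian `g` on a regular manifold (any finite-dimensional normed model space `E`,
boundaryless model) and `x₀ ∈ M`, `φ = extChartAt I x₀`, there are an open neighbourhood `U` of
`x₀` inside the chart domain and a constant `C` such that on `U`:
`d_g(q, q') ≤ C ‖φ q - φ q'‖`, `‖φ q - φ q'‖ ≤ C d_g(q, q')`, and `|D(φ⁻¹)_{φ q} w|_g ≤ C ‖w‖`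
for all `w ∈ E` (Mathlib's local bounds `eventually_norm_mfderivWithin_symm_extChartAt_lt`,
`eventually_norm_mfderiv_extChartAt_lt` integrated along chart segments, resp. almost-minimising
paths: `riemannianEDist_symm_le_of_forall_norm_mfderivWithin_le`,
`exists_enorm_sub_le_mul_riemannianEDist_of_forall_norm_le` of `VolumeChartFormula.lean`).
Burago–Burago–Ivanov, *A course in metric geometry* (2001), §5.1. [folklore] -/
theorem exists_isOpen_biLipschitz_extChartAt [RegularSpace M] (hg : g.IsRiemannian) (x₀ : M) :
    ∃ U : Set M, IsOpen U ∧ x₀ ∈ U ∧ U ⊆ (chartAt H x₀).source ∧ ∃ C : ℝ≥0, 0 < C ∧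
      (∀ q ∈ U, ∀ q' ∈ U, g.edist hg q q' ≤ C * edist (extChartAt I x₀ q) (extChartAt I x₀ q')) ∧
      (∀ q ∈ U, ∀ q' ∈ U, edist (extChartAt I x₀ q) (extChartAt I x₀ q') ≤ C * g.edist hg q q') ∧
      (∀ q ∈ U, ∀ w : E, g.val q
          (mfderivWithin 𝓘(ℝ, E) I (extChartAt I x₀).symm (range I) (extChartAt I x₀ q) w)
          (mfderivWithin 𝓘(ℝ, E) I (extChartAt I x₀).symm (range I) (extChartAt I x₀ q) w) ≤
        (C : ℝ) ^ 2 * ‖w‖ ^ 2) := by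
  letI := g.riemannianBundle hg
  haveI := g.isContinuousRiemannianBundle hg
  letI _i₁ : (p : E) → NormedAddCommGroup (TangentSpace 𝓘(ℝ, E) p) := fun p ↦
    normedAddCommGroupTangentSpaceVectorSpace p
  letI _i₂ : (p : E) → NormedSpace ℝ (TangentSpace 𝓘(ℝ, E) p) := fun p ↦
    normedSpaceTangentSpaceVectorSpace p
  set φ := extChartAt I x₀ with hφ
  -- (1) bound on `D(φ⁻¹)` on a ball around `φ x₀`, and the upper bound for `d_g`
  obtain ⟨C₁, hC₁, hD₁⟩ := eventually_norm_mfderivWithin_symm_extChartAt_lt I x₀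
  have hnhds : 𝓝[range I] (φ x₀) = 𝓝 (φ x₀) := by
    rw [ModelWithCorners.Boundaryless.range_eq_univ, nhdsWithin_univ]
  rw [hnhds] at hD₁
  obtain ⟨r, hr, hball⟩ : ∃ r > 0, ball (φ x₀) r ⊆ φ.target ∩
      {y | ‖mfderivWithin 𝓘(ℝ, E) I φ.symm (range I) y‖ < C₁} :=
    Metric.mem_nhds_iff.1 (inter_mem ((isOpen_extChartAt_target x₀).mem_nhds
      (mem_extChartAt_target x₀)) hD₁)
  lift C₁ to ℝ≥0 using hC₁.le
  have hDball : ∀ z ∈ ball (φ x₀) r, ∀ w : E,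
      ‖mfderivWithin 𝓘(ℝ, E) I φ.symm (range I) z w‖ ≤ C₁ * ‖(ContinuousLinearMap.id ℝ E) w‖ := by
    intro z hz w
    have h := (hball hz).2
    simp only [mem_setOf_eq] at h
    rw [ContinuousLinearMap.id_apply]
    exact (ContinuousLinearMap.le_opNorm _ w).trans (mul_le_mul_of_nonneg_right h.le (norm_nonneg w))
  set U₁ : Set M := φ.source ∩ φ ⁻¹' ball (φ x₀) r with hU₁
  have hU₁o : IsOpen U₁ := isOpen_extChartAt_preimage' x₀ isOpen_ball
  have hxU₁ : x₀ ∈ U₁ := ⟨mem_extChartAt_source x₀, mem_ball_self hr⟩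
  have hup : ∀ q ∈ U₁, ∀ q' ∈ U₁, g.edist hg q q' ≤ C₁ * edist (φ q) (φ q') := by
    intro q hq q' hq'
    have h := riemannianEDist_symm_le_of_forall_norm_mfderivWithin_le (I := I) x₀
      (ContinuousLinearMap.id ℝ E) (convex_ball (φ x₀) r) (fun z hz ↦ (hball hz).1) hDball
      hq.2 hq'.2
    rw [φ.left_inv hq.1, φ.left_inv hq'.1] at h
    simp only [ContinuousLinearMap.id_apply] at h
    exact h
  -- (2) bound on `Dφ` near `x₀`, and the lower bound for `d_g`
  obtain ⟨C₂, hC₂, hD₂⟩ := eventually_norm_mfderiv_extChartAt_lt I x₀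
  obtain ⟨u, hu, hus, hD₂'⟩ : ∃ u ∈ 𝓝 x₀, u ⊆ (chartAt H x₀).source ∧
      ∀ q ∈ u, ‖mfderiv I 𝓘(ℝ, E) φ q‖ < C₂ := by
    have := inter_mem ((chartAt H x₀).open_source.mem_nhds (mem_chart_source H x₀)) hD₂
    exact ⟨_, this, inter_subset_left, fun q hq ↦ hq.2⟩
  lift C₂ to ℝ≥0 using hC₂.le
  obtain ⟨s, hs, hlow⟩ := exists_enorm_sub_le_mul_riemannianEDist_of_forall_norm_le (I := I)
    x₀ x₀ (ContinuousLinearMap.id ℝ E) hu hus (C := C₂) (fun q hq v ↦ by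
      rw [ContinuousLinearMap.id_apply]
      exact (ContinuousLinearMap.le_opNorm _ v).trans
        (mul_le_mul_of_nonneg_right (hD₂' q hq).le (norm_nonneg v)))
  -- the neighbourhood
  obtain ⟨U, hUsub, hUo, hxU⟩ := mem_nhds_iff.1 (inter_mem (hU₁o.mem_nhds hxU₁) hs)
  have hCle₁ : (C₁ : ℝ≥0) ≤ max C₁ C₂ + 1 := (le_max_left _ _).trans (le_add_of_nonneg_right zero_le_one)
  have hCle₂ : (C₂ : ℝ≥0) ≤ max C₁ C₂ + 1 := (le_max_right _ _).trans (le_add_of_nonneg_right zero_le_one)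
  refine ⟨U, hUo, hxU, fun q hq ↦ ?_, max C₁ C₂ + 1, by positivity, ?_, ?_, ?_⟩
  · rw [← extChartAt_source I]; exact (hUsub hq).1.1
  · intro q hq q' hq'
    refine (hup q (hUsub hq).1 q' (hUsub hq').1).trans ?_
    gcongr
  · intro q hq q' hq'
    have h := hlow q (hUsub hq).2 q' (hUsub hq').2
    simp only [ContinuousLinearMap.id_apply] at h
    change _ ≤ (C₂ : ℝ≥0∞) * g.edist hg q q' at h
    rw [edist_eq_enorm_sub]
    refine h.trans ?_
    gcongr
  · intro q hq w
    have hz : φ q ∈ ball (φ x₀) r := (hUsub hq).1.2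
    have h := hDball (φ q) hz w
    simp only [ContinuousLinearMap.id_apply] at h
    have hq' : φ.symm (φ q) = q := φ.left_inv (hUsub hq).1.1
    -- `g(v, v) = ‖v‖²`
    have hvv : ∀ (b : M) (v : TangentSpace I b), g.val b v v = ‖v‖ ^ 2 := fun b v ↦ by
      rw [g.norm_eq_sqrt hg, Real.sq_sqrt]
      by_cases h0 : v = 0
      · rw [h0]; simp
      · exact (hg b v h0).le
    have h1 : g.val (φ.symm (φ q)) (mfderivWithin 𝓘(ℝ, E) I φ.symm (range I) (φ q) w)
        (mfderivWithin 𝓘(ℝ, E) I φ.symm (range I) (φ q) w) ≤ ((C₁ : ℝ) * ‖w‖) ^ 2 := by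
      rw [hvv]
      exact pow_le_pow_left₀ (norm_nonneg _) h 2
    rw [hq'] at h1
    refine h1.trans ?_
    rw [mul_pow]
    gcongr

end BiLipschitz

/-! ### Comparison of the Riemannian measure with the model measure in a chart -/

section Measure

variable {E : Type*} [NormedAddCommGroup E] [NormedSpace ℝ E] [FiniteDimensional ℝ E]
  [MeasurableSpace E] [BorelSpace E]
  {H : Type*} [TopologicalSpace H] {I : ModelWithCorners ℝ E H} [I.Boundaryless]
  {M : Type*} [TopologicalSpace M] [ChartedSpace H M] [IsManifold I ∞ M] [T3Space M]
  [MeasurableSpace M] [BorelSpace M]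
  (g : PseudoRiemannianMetric I ∞ E (TangentSpace I : M → Type _))

omit [I.Boundaryless] in
/-- **Riemannian volume vs. model Hausdorff measure under a bi-Lipschitz chart** (Federer 1969,
§2.10.11: a `C`-Lipschitz map expands `μH[n]` by at most `Cⁿ`). If on `U` (inside the chart
domain of `x₀`, `φ = extChartAt I x₀`) `d_g(q,q') ≤ C ‖φ q - φ q'‖` and `‖φ q - φ q'‖ ≤ C d_g(q,q')`,
then for every `s ⊆ U`: `Vol_g(s) ≤ Cⁿ μHE[n](φ s)` and `μHE[n](φ s) ≤ Cⁿ Vol_g(s)`, `n = dim M`,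
`μHE[n]` the Euclidean-normalised Hausdorff measure of the model space `E` (an additive Haar
measure) and `Vol_g = g.riemVolume` (the same normalisation of the Hausdorff measure of `d_g`).
[cite: Federer1969, §2.10.11] -/
theorem vol_le_and_le_of_biLipschitz (hg : g.IsRiemannian) (x₀ : M) {U : Set M}
    (hUs : U ⊆ (chartAt H x₀).source) {C : ℝ≥0}
    (hup : ∀ q ∈ U, ∀ q' ∈ U, g.edist hg q q' ≤ C * edist (extChartAt I x₀ q) (extChartAt I x₀ q'))
    (hlow : ∀ q ∈ U, ∀ q' ∈ U, edist (extChartAt I x₀ q) (extChartAt I x₀ q') ≤ C * g.edist hg q q')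
    {s : Set M} (hs : s ⊆ U) :
    g.vol s ≤ (C : ℝ≥0∞) ^ finrank ℝ E * (μHE[finrank ℝ E] : Measure E) (extChartAt I x₀ '' s) ∧
      (μHE[finrank ℝ E] : Measure E) (extChartAt I x₀ '' s) ≤ (C : ℝ≥0∞) ^ finrank ℝ E * g.vol s := by
  letI := g.riemannianBundle hg
  haveI := g.isContinuousRiemannianBundle hg
  letI : EMetricSpace M := EMetricSpace.ofRiemannianMetric I M
  set φ := extChartAt I x₀ with hφ
  set n := finrank ℝ E with hn
  have hvol : ∀ t : Set M, g.vol t = (μHE[n] : Measure M) t := by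
    intro t
    rw [PseudoRiemannianMetric.vol, PseudoRiemannianMetric.riemVolume_eq hg]
    rfl
  have hUs' : U ⊆ φ.source := by rwa [hφ, extChartAt_source]
  -- `φ` is `C`-Lipschitz on `U`, `φ⁻¹` is `C`-Lipschitz on `φ '' U`
  have hL₁ : LipschitzOnWith C φ U := fun q hq q' hq' ↦ hlow q hq q' hq'
  have hL₂ : LipschitzOnWith C φ.symm (φ '' U) := by
    rintro _ ⟨q, hq, rfl⟩ _ ⟨q', hq', rfl⟩
    rw [φ.left_inv (hUs' hq), φ.left_inv (hUs' hq')]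
    exact hup q hq q' hq'
  have hs' : s ⊆ φ.symm '' (φ '' s) := fun q hq ↦
    ⟨φ q, mem_image_of_mem φ hq, φ.left_inv (hUs' (hs hq))⟩
  have hd : (0 : ℝ) ≤ (n : ℝ) := n.cast_nonneg
  constructor
  · rw [hvol, Measure.euclideanHausdorffMeasure_def, Measure.euclideanHausdorffMeasure_def,
      Measure.smul_apply, Measure.smul_apply, ENNReal.smul_def, ENNReal.smul_def, smul_eq_mul,
      smul_eq_mul, mul_left_comm]
    gcongr
    calc μH[(n : ℝ)] s ≤ μH[(n : ℝ)] (φ.symm '' (φ '' s)) := measure_mono hs'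
      _ ≤ (C : ℝ≥0∞) ^ (n : ℝ) * μH[(n : ℝ)] (φ '' s) :=
          (hL₂.mono (image_mono hs)).hausdorffMeasure_image_le hd
      _ = (C : ℝ≥0∞) ^ n * μH[(n : ℝ)] (φ '' s) := by rw [ENNReal.rpow_natCast]
  · rw [hvol, Measure.euclideanHausdorffMeasure_def, Measure.euclideanHausdorffMeasure_def,
      Measure.smul_apply, Measure.smul_apply, ENNReal.smul_def, ENNReal.smul_def, smul_eq_mul,
      smul_eq_mul, mul_left_comm]
    gcongr
    calc μH[(n : ℝ)] (φ '' s) ≤ (C : ℝ≥0∞) ^ (n : ℝ) * μH[(n : ℝ)] s :=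
          (hL₁.mono hs).hausdorffMeasure_image_le hd
      _ = (C : ℝ≥0∞) ^ n * μH[(n : ℝ)] s := by rw [ENNReal.rpow_natCast]

/-- **Integrals over a bi-Lipschitz chart domain**: with `U` open as in
`vol_le_and_le_of_biLipschitz` and `f : M → [0, ∞]` measurable,
`∫_U f dVol_g ≤ Cⁿ ∫_{φ U} f ∘ φ⁻¹ dμHE[n]` and `∫_{φ U} f ∘ φ⁻¹ dμHE[n] ≤ Cⁿ ∫_U f dVol_g`
(the push-forward of `μHE[n]|_{φ U}` under `φ⁻¹` is squeezed between `C⁻ⁿ Vol_g|_U` and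
`Cⁿ Vol_g|_U`). [cite: Federer1969, §2.10.11] -/
theorem lintegral_le_and_le_of_biLipschitz (hg : g.IsRiemannian) (x₀ : M) {U : Set M}
    (hUo : IsOpen U) (hUs : U ⊆ (chartAt H x₀).source) {C : ℝ≥0}
    (hup : ∀ q ∈ U, ∀ q' ∈ U, g.edist hg q q' ≤ C * edist (extChartAt I x₀ q) (extChartAt I x₀ q'))
    (hlow : ∀ q ∈ U, ∀ q' ∈ U, edist (extChartAt I x₀ q) (extChartAt I x₀ q') ≤ C * g.edist hg q q')
    {f : M → ℝ≥0∞} (hf : Measurable f) :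
    (∫⁻ x in U, f x ∂g.riemVolume) ≤ (C : ℝ≥0∞) ^ finrank ℝ E *
        ∫⁻ y in extChartAt I x₀ '' U, f ((extChartAt I x₀).symm y) ∂(μHE[finrank ℝ E] : Measure E) ∧
      (∫⁻ y in extChartAt I x₀ '' U, f ((extChartAt I x₀).symm y) ∂(μHE[finrank ℝ E] : Measure E)) ≤
        (C : ℝ≥0∞) ^ finrank ℝ E * ∫⁻ x in U, f x ∂g.riemVolume := by
  set φ := extChartAt I x₀ with hφ
  set n := finrank ℝ E with hn
  set μE : Measure E := μHE[n] with hμE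
  have hUs' : U ⊆ φ.source := by rwa [hφ, extChartAt_source]
  -- `φ '' U` is open, `φ⁻¹` is a.e.-measurable on it
  have himg : φ '' U = φ.target ∩ φ.symm ⁻¹' U := φ.image_eq_target_inter_inv_preimage hUs'
  have hVo : IsOpen (φ '' U) := by
    rw [himg]
    exact (continuousOn_extChartAt_symm x₀).isOpen_inter_preimage (isOpen_extChartAt_target x₀) hUo
  have hVm : MeasurableSet (φ '' U) := hVo.measurableSet
  have hsymm : AEMeasurable φ.symm (μE.restrict (φ '' U)) :=
    ((continuousOn_extChartAt_symm x₀).mono (by rw [himg]; exact inter_subset_left)).aemeasurable hVm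
  -- the push-forward `ν = (φ⁻¹)_* (μE|_{φ U})`
  set ν : Measure M := (μE.restrict (φ '' U)).map φ.symm with hν
  have hνapp : ∀ B : Set M, MeasurableSet B → ν B = μE (φ.symm ⁻¹' B ∩ φ '' U) := fun B hB ↦ by
    rw [hν, Measure.map_apply_of_aemeasurable hsymm hB, Measure.restrict_apply' hVm]
  have hvol : ∀ s ⊆ U, g.vol s ≤ (C : ℝ≥0∞) ^ n * μE (φ '' s) ∧ μE (φ '' s) ≤ (C : ℝ≥0∞) ^ n * g.vol s :=
    fun s hs ↦ vol_le_and_le_of_biLipschitz g hg x₀ hUs hup hlow hs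
  -- (i) `Vol|_U ≤ Cⁿ ν`
  have h1 : g.riemVolume.restrict U ≤ (C : ℝ≥0∞) ^ n • ν := by
    refine Measure.le_iff.2 (fun B hB ↦ ?_)
    rw [Measure.restrict_apply hB, Measure.smul_apply, smul_eq_mul, hνapp B hB]
    have hsub : φ '' (B ∩ U) ⊆ φ.symm ⁻¹' B ∩ φ '' U := by
      rintro _ ⟨q, hq, rfl⟩
      refine ⟨?_, mem_image_of_mem φ hq.2⟩
      rw [mem_preimage, φ.left_inv (hUs' hq.2)]
      exact hq.1
    calc g.riemVolume (B ∩ U) = g.vol (B ∩ U) := rfl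
      _ ≤ (C : ℝ≥0∞) ^ n * μE (φ '' (B ∩ U)) := (hvol _ inter_subset_right).1
      _ ≤ (C : ℝ≥0∞) ^ n * μE (φ.symm ⁻¹' B ∩ φ '' U) := by gcongr
  -- (ii) `ν ≤ Cⁿ Vol|_U`
  have h2 : ν ≤ (C : ℝ≥0∞) ^ n • g.riemVolume.restrict U := by
    refine Measure.le_iff.2 (fun B hB ↦ ?_)
    rw [hνapp B hB, Measure.smul_apply, smul_eq_mul, Measure.restrict_apply hB]
    have hsub : φ.symm ⁻¹' B ∩ φ '' U ⊆ φ '' (B ∩ U) := by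
      rintro y ⟨hyB, q, hq, rfl⟩
      refine ⟨q, ⟨?_, hq⟩, rfl⟩
      rw [mem_preimage, φ.left_inv (hUs' hq)] at hyB
      exact hyB
    calc μE (φ.symm ⁻¹' B ∩ φ '' U) ≤ μE (φ '' (B ∩ U)) := measure_mono hsub
      _ ≤ (C : ℝ≥0∞) ^ n * g.vol (B ∩ U) := (hvol _ inter_subset_right).2
  -- integrals against `ν`
  have hint : ∫⁻ x, f x ∂ν = ∫⁻ y in φ '' U, f (φ.symm y) ∂μE :=
    lintegral_map' hf.aemeasurable hsymm
  constructor
  · calc ∫⁻ x in U, f x ∂g.riemVolume ≤ ∫⁻ x, f x ∂((C : ℝ≥0∞) ^ n • ν) := lintegral_mono' h1 le_rfl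
      _ = (C : ℝ≥0∞) ^ n * ∫⁻ y in φ '' U, f (φ.symm y) ∂μE := by
          rw [lintegral_smul_measure, hint, smul_eq_mul]
  · calc ∫⁻ y in φ '' U, f (φ.symm y) ∂μE = ∫⁻ x, f x ∂ν := hint.symm
      _ ≤ ∫⁻ x, f x ∂((C : ℝ≥0∞) ^ n • g.riemVolume.restrict U) := lintegral_mono' h2 le_rfl
      _ = (C : ℝ≥0∞) ^ n * ∫⁻ x in U, f x ∂g.riemVolume := by
          rw [lintegral_smul_measure, smul_eq_mul]

end Measure

end Literature.Geometry.Riemannian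

end
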